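import Literature.Analysis.OperatorTheory.L2KernelIntegralOperator
import Literature.NumberTheory.LFunctions.SuzukiStructureFunctions
import Mathlib.MeasureTheory.Measure.Lebesgue.Basic
import HarnessLib

/-!
# SuzukiStructureFunctionsWindowFamily — Suzuki's window operators `𝖪[t]` on the FIXED space `L²(ℝ)`:
# a Hilbert–Schmidt family, `½`-Hölder (hence norm-continuous) in `t` (JFA21 (2.9), §3.1; column DBR; RH-FREE)

LINE 1 — LABEL: RH-FREE (ζ-free operator theory for ANY continuous kernel; no zeros, no positivity); bears_on
LADDER-RH B-D → B-P(P2)/(P1): continuity of the window data in `t` — the first input of Thm. 3.1 (2) (the declared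
residual `Suzuki2021_thm31_dynamics`) and of the column's window-norm laws (`t ↦ ‖𝖪_θ[t]‖` is continuous).
WHAT THIS IS NOT: not progress toward RH; nothing here bears on the truth of RH.

Source: M. Suzuki, J. Funct. Anal. 281 (2021) 109116 = arXiv:1606.05726 [Suzuki2021Hamiltonians], §3.1 («the map
`𝖪[t]` defines a Hilbert–Schmidt operator … the Hilbert–Schmidt norm of `𝖪[t]` is finite: `∫∫|K(x+y)|² ≤ 2t∫₀^{2t}|K|²`»),
eq. (2.9); Reed–Simon I Thm. VI.23 (tree: `Literature.Analysis.OperatorTheory.exists_l2KernelOp`).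

Contents (seat rh-dbr-eng-5 g7): `winKer K t` (the kernel `𝟙_{[−t,t]²}(x,y)K(x+y)`), `memLp_winKer` (square
integrable), `integral_sq_winKer_sub_le` (**HS increment** `∫∫(k_t − k_s)² ≤ C_T²((2t)² − (2s)²)`), `winOpL2 K hK t` (the
operator on `L²(ℝ)`, chosen once so that `t ↦ 𝖪[t]` is a family), `winOpL2_spec` (a.e. kernel formula),
`norm_winOpL2_sub_le` (`‖𝖪[t] − 𝖪[s]‖ ≤ ‖k_t − k_s‖_{L²}`), `norm_winOpL2_sub_le_sqrt` (½-Hölder bound),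
**`continuousOn_winOpL2`** (norm continuity on `[0,∞)`), `continuousOn_norm_winOpL2`.
Design: the FIXED ambient space `L²(ℝ)` (instead of `L²(−t,t)`, which moves with `t`) is what makes continuity in
`t` a statement about one operator family; for kernels vanishing on `(−∞,0)` the extra cutoff `𝟙_{[−t,t]}(x)` is
Suzuki's `𝟙_{(−∞,t]}(x)` (Lemma 3.3: `φ_t` vanishes below `−t`).
-/

noncomputable section

-- D-0017: `Summit.<S>.<S>.…` is the designed namespace of a single-problem summit.
set_option linter.dupNamespace false

open MeasureTheory Set Filter Topology Function
open scoped ENNReal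

namespace Summit.RiemannHypothesis.RiemannHypothesis.Theorems.SuzukiStructureFunctions

open Literature.Analysis.OperatorTheory

variable {K : ℝ → ℝ}

/-! ## §15 Suzuki's window operators `𝖪[t]` realised on the FIXED space `L²(ℝ)`: a Hilbert–Schmidt family,
`½`-Hölder continuous in `t` (first step of Thm. 3.1 (2): continuity of the data in `t`)

For a continuous kernel `K`, the operator `𝖪[t]f(x) = 𝟙_{[−t,t]}(x)∫_{[−t,t]} K(x+y)f(y) dy` (Suzuki JFA21 (2.9), for a
kernel vanishing on `(−∞,0)` this is `𝟙_{(−∞,t]}(x)∫_{−∞}^t K(x+y)f(y) dy`) is realised on `L²(ℝ)` by the square-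
integrable kernel `k_t = 𝟙_{[−t,t]²}·K(x+y)`; since `‖k_t − k_s‖²_{L²(ℝ²)} ≤ (sup_{[−2T,2T]}K²)·4(t² − s²)` for
`0 ≤ s ≤ t ≤ T`, the family `t ↦ 𝖪[t]` is norm-continuous (½-Hölder) on `[0,∞)`. -/

/-- The two-dimensional window kernel `k_t(x,y) = 𝟙_{[−t,t]×[−t,t]}(x,y)·K(x+y)`. -/
def winKer (K : ℝ → ℝ) (t : ℝ) (x y : ℝ) : ℝ :=
  (Icc (-t) t ×ˢ Icc (-t) t).indicator (fun p : ℝ × ℝ => K (p.1 + p.2)) (x, y)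

/-- RH-FREE. Unfolding of the window kernel as an indicator on `ℝ × ℝ`. -/
theorem uncurry_winKer (K : ℝ → ℝ) (t : ℝ) :
    uncurry (winKer K t) = (Icc (-t) t ×ˢ Icc (-t) t).indicator (fun p : ℝ × ℝ => K (p.1 + p.2)) := by
  funext p
  rfl

/-- RH-FREE. The window square has finite (product Lebesgue) measure `(2t)·(2t)` … here only finiteness. -/
theorem volume_prod_winSquare_lt_top (t : ℝ) :
    ((volume : Measure ℝ).prod volume) (Icc (-t) t ×ˢ Icc (-t) t) < ∞ := by
  rw [Measure.prod_prod]
  exact ENNReal.mul_lt_top measure_Icc_lt_top measure_Icc_lt_top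

/-- RH-FREE. A bound for `K` on `[−2T, 2T]` controls `K(x+y)` on every window square `[−t,t]²`, `|t| ≤ T`. -/
theorem exists_bound_kernel_winSquare (hK : Continuous K) (T : ℝ) :
    ∃ C : ℝ, 0 ≤ C ∧ ∀ t : ℝ, |t| ≤ T → ∀ p : ℝ × ℝ, p ∈ Icc (-t) t ×ˢ Icc (-t) t → |K (p.1 + p.2)| ≤ C := by
  obtain ⟨C, hC⟩ := (isCompact_Icc (a := -(2 * T)) (b := 2 * T)).exists_bound_of_continuousOn hK.continuousOn
  refine ⟨max C 0, le_max_right _ _, fun t ht p hp => ?_⟩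
  have h := hC (p.1 + p.2) ⟨by nlinarith [hp.1.1, hp.2.1, le_abs_self t, neg_abs_le t],
    by nlinarith [hp.1.2, hp.2.2, le_abs_self t]⟩
  rw [Real.norm_eq_abs] at h
  exact h.trans (le_max_left _ _)

/-- RH-FREE. **The window kernel is square integrable on `ℝ × ℝ`** (bounded on a set of finite measure). -/
theorem memLp_winKer (hK : Continuous K) (t : ℝ) :
    MemLp (uncurry (winKer K t)) 2 ((volume : Measure ℝ).prod volume) := by
  rw [uncurry_winKer, memLp_indicator_iff_restrict (measurableSet_Icc.prod measurableSet_Icc)]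
  haveI : IsFiniteMeasure (((volume : Measure ℝ).prod volume).restrict (Icc (-t) t ×ˢ Icc (-t) t)) :=
    ⟨by rw [Measure.restrict_apply_univ]; exact volume_prod_winSquare_lt_top t⟩
  obtain ⟨C, _, hC⟩ := exists_bound_kernel_winSquare hK |t|
  refine MemLp.of_bound ((hK.comp (continuous_fst.add continuous_snd)).aestronglyMeasurable) C ?_
  rw [ae_restrict_iff' (measurableSet_Icc.prod measurableSet_Icc)]
  exact Eventually.of_forall fun p hp => by rw [Real.norm_eq_abs]; exact hC t le_rfl p hp

/-- RH-FREE. Every section `k_t(x,·)` is square integrable on `ℝ`. -/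
theorem memLp_winKer_section (hK : Continuous K) (t x : ℝ) : MemLp (winKer K t x) 2 (volume : Measure ℝ) := by
  have e : winKer K t x = (Icc (-t) t).indicator (fun y : ℝ => (Icc (-t) t).indicator (fun _ => (1 : ℝ)) x * K (x + y)) := by
    funext y
    simp only [winKer]
    by_cases hy : y ∈ Icc (-t) t
    · by_cases hx : x ∈ Icc (-t) t
      · rw [indicator_of_mem (mem_prod.2 ⟨hx, hy⟩), indicator_of_mem hy, indicator_of_mem hx, one_mul]
      · rw [indicator_of_notMem (fun h => hx (mem_prod.1 h).1), indicator_of_mem hy, indicator_of_notMem hx,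
          zero_mul]
    · rw [indicator_of_notMem (fun h => hy (mem_prod.1 h).2), indicator_of_notMem hy]
  rw [e, memLp_indicator_iff_restrict measurableSet_Icc]
  haveI : IsFiniteMeasure ((volume : Measure ℝ).restrict (Icc (-t) t)) := by infer_instance
  obtain ⟨C, hC0, hC⟩ := exists_bound_kernel_winSquare hK |t|
  refine MemLp.of_bound ((continuous_const.mul (hK.comp (continuous_const.add continuous_id))).aestronglyMeasurable)
    C ?_
  rw [ae_restrict_iff' measurableSet_Icc]
  refine Eventually.of_forall fun y hy => ?_
  rw [Real.norm_eq_abs, abs_mul]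
  by_cases hx : x ∈ Icc (-t) t
  · rw [indicator_of_mem hx, abs_one, one_mul]
    exact hC t le_rfl (x, y) (mem_prod.2 ⟨hx, hy⟩)
  · rw [indicator_of_notMem hx, abs_zero, zero_mul]; exact hC0

/-- RH-FREE. `y ↦ k_t(x,y)φ(y)` is integrable for every `φ ∈ L²(ℝ)` and every `x`. -/
theorem integrable_winKer_mul (hK : Continuous K) (t x : ℝ) (φ : Lp ℝ 2 (volume : Measure ℝ)) :
    Integrable (fun y : ℝ => winKer K t x y * φ y) := (memLp_winKer_section hK t x).integrable_mul (Lp.memLp φ)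

/-- RH-FREE. **Hilbert–Schmidt increment of the window kernels:** for `0 ≤ s ≤ t` with `|t| ≤ T`,
`∫∫ (k_t − k_s)² ≤ C_T² · ((2t)² − (2s)²)` with `C_T = sup_{[−2T,2T]}|K|` (the difference lives on the frame
`[−t,t]² ∖ [−s,s]²`). -/
theorem integral_sq_winKer_sub_le (hK : Continuous K) (T : ℝ) :
    ∃ C : ℝ, 0 ≤ C ∧ ∀ s t : ℝ, 0 ≤ s → s ≤ t → t ≤ T →
      ∫ p : ℝ × ℝ, (winKer K t p.1 p.2 - winKer K s p.1 p.2) ^ 2 ∂((volume : Measure ℝ).prod volume) ≤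
        C ^ 2 * ((2 * t) * (2 * t) - (2 * s) * (2 * s)) := by
  obtain ⟨C, hC0, hC⟩ := exists_bound_kernel_winSquare hK T
  refine ⟨C, hC0, fun s t hs hst htT => ?_⟩
  set St : Set (ℝ × ℝ) := Icc (-t) t ×ˢ Icc (-t) t with hSt
  set Ss : Set (ℝ × ℝ) := Icc (-s) s ×ˢ Icc (-s) s with hSs
  have hsub : Ss ⊆ St := prod_mono (Icc_subset_Icc (by linarith) hst) (Icc_subset_Icc (by linarith) hst)
  have hmeasSt : MeasurableSet St := measurableSet_Icc.prod measurableSet_Icc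
  have hmeasSs : MeasurableSet Ss := measurableSet_Icc.prod measurableSet_Icc
  -- the squared difference is the indicator of the frame times `K²`
  have hpt : ∀ p : ℝ × ℝ, (winKer K t p.1 p.2 - winKer K s p.1 p.2) ^ 2 =
      (St \ Ss).indicator (fun p : ℝ × ℝ => K (p.1 + p.2) ^ 2) p := by
    intro p
    have e : winKer K t p.1 p.2 - winKer K s p.1 p.2 = (St \ Ss).indicator (fun p : ℝ × ℝ => K (p.1 + p.2)) p := by
      simp only [winKer, Prod.mk.eta, ← hSt, ← hSs]
      rw [indicator_sdiff hsub]
      simp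
    rw [e]
    by_cases hp : p ∈ St \ Ss
    · rw [indicator_of_mem hp, indicator_of_mem hp]
    · rw [indicator_of_notMem hp, indicator_of_notMem hp]; ring
  simp_rw [hpt]
  rw [integral_indicator (hmeasSt.diff hmeasSs)]
  have hfin : ((volume : Measure ℝ).prod volume) (St \ Ss) < ∞ :=
    (measure_mono fun p (hp : p ∈ St \ Ss) => hp.1).trans_lt (volume_prod_winSquare_lt_top t)
  have hbound := norm_setIntegral_le_of_norm_le_const hfin (f := fun p : ℝ × ℝ => K (p.1 + p.2) ^ 2)
    (C := C ^ 2) (fun p hp => by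
      rw [Real.norm_eq_abs, abs_pow]
      exact pow_le_pow_left₀ (abs_nonneg _) (hC t (abs_le.2 ⟨by linarith, htT⟩) p hp.1) 2)
  rw [Real.norm_eq_abs, abs_of_nonneg (integral_nonneg fun p => sq_nonneg _)] at hbound
  refine hbound.trans ?_
  -- the measure of the frame
  have hreal : (((volume : Measure ℝ).prod volume).real (St \ Ss)) = (2 * t) * (2 * t) - (2 * s) * (2 * s) := by
    rw [measureReal_sdiff hsub hmeasSs (volume_prod_winSquare_lt_top t).ne, hSt, hSs,
      measureReal_prod_prod, measureReal_prod_prod, Real.volume_real_Icc_of_le (by linarith),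
      Real.volume_real_Icc_of_le (by linarith)]
    ring
  rw [hreal]

/-- **The window operator `𝖪[t]` on `L²(ℝ)`** (a bounded operator with kernel `k_t`, Reed–Simon VI.23 via the tree's
`exists_l2KernelOp`; chosen once and for all so that `t ↦ 𝖪[t]` is a genuine family). -/
def winOpL2 (K : ℝ → ℝ) (hK : Continuous K) (t : ℝ) :
    Lp ℝ 2 (volume : Measure ℝ) →L[ℝ] Lp ℝ 2 (volume : Measure ℝ) :=
  (exists_l2KernelOp (memLp_winKer hK t)).choose

/-- RH-FREE. The a.e. kernel formula of `𝖪[t]` on `L²(ℝ)`: `(𝖪[t]φ)(x) = ∫ k_t(x,y)φ(y) dy` for a.e. `x`. -/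
theorem winOpL2_spec (hK : Continuous K) (t : ℝ) (φ : Lp ℝ 2 (volume : Measure ℝ)) :
    (winOpL2 K hK t φ : ℝ → ℝ) =ᵐ[volume] fun x => ∫ y, winKer K t x y * φ y :=
  (exists_l2KernelOp (memLp_winKer hK t)).choose_spec φ

/-- RH-FREE. **`‖𝖪[t] − 𝖪[s]‖ ≤ ‖k_t − k_s‖_{L²(ℝ²)}`** (the difference is the integral operator of the difference
kernel; Hilbert–Schmidt bound). -/
theorem norm_winOpL2_sub_le (hK : Continuous K) (s t : ℝ) :
    ‖winOpL2 K hK t - winOpL2 K hK s‖ ≤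
      Real.sqrt (∫ p : ℝ × ℝ, (winKer K t p.1 p.2 - winKer K s p.1 p.2) ^ 2 ∂((volume : Measure ℝ).prod volume)) := by
  have hdiff : MemLp (uncurry fun x y : ℝ => winKer K t x y - winKer K s x y) 2 ((volume : Measure ℝ).prod volume) :=
    (memLp_winKer hK t).sub (memLp_winKer hK s)
  refine ContinuousLinearMap.opNorm_le_bound _ (Real.sqrt_nonneg _) fun φ => ?_
  -- `(𝖪[t] − 𝖪[s])φ` is the `L²` class of `x ↦ ∫ (k_t − k_s)(x,y)φ(y) dy`
  have hae : ((winOpL2 K hK t - winOpL2 K hK s) φ : ℝ → ℝ) =ᵐ[volume]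
      fun x => ∫ y, (winKer K t x y - winKer K s x y) * φ y := by
    have h1 := winOpL2_spec hK t φ
    have h2 := winOpL2_spec hK s φ
    have h3 := Lp.coeFn_sub (winOpL2 K hK t φ) (winOpL2 K hK s φ)
    rw [show (winOpL2 K hK t - winOpL2 K hK s) φ = winOpL2 K hK t φ - winOpL2 K hK s φ from rfl]
    filter_upwards [h1, h2, h3] with x e1 e2 e3
    rw [e3, Pi.sub_apply, e1, e2, ← integral_sub (integrable_winKer_mul hK t x φ) (integrable_winKer_mul hK s x φ)]
    refine integral_congr_ae (Eventually.of_forall fun y => ?_)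
    simp only
    ring
  have heq : (winOpL2 K hK t - winOpL2 K hK s) φ = (memLp_two_integral_l2Kernel_mul hdiff φ).toLp _ :=
    Lp.ext (hae.trans (MemLp.coeFn_toLp _).symm)
  rw [heq]
  exact norm_toLp_integral_l2Kernel_mul_le hdiff φ

/-- RH-FREE. **The window operator family is ½-Hölder in `t`:** on `0 ≤ s ≤ t ≤ T`,
`‖𝖪[t] − 𝖪[s]‖ ≤ C_T √((2t)² − (2s)²)`. -/
theorem norm_winOpL2_sub_le_sqrt (hK : Continuous K) (T : ℝ) :
    ∃ C : ℝ, 0 ≤ C ∧ ∀ s t : ℝ, 0 ≤ s → s ≤ t → t ≤ T →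
      ‖winOpL2 K hK t - winOpL2 K hK s‖ ≤ C * Real.sqrt ((2 * t) * (2 * t) - (2 * s) * (2 * s)) := by
  obtain ⟨C, hC0, hC⟩ := integral_sq_winKer_sub_le hK T
  refine ⟨C, hC0, fun s t hs hst htT => (norm_winOpL2_sub_le hK s t).trans ?_⟩
  rw [← Real.sqrt_sq hC0, ← Real.sqrt_mul (sq_nonneg C)]
  exact Real.sqrt_le_sqrt (hC s t hs hst htT)

/-- **RH-FREE · `t ↦ 𝖪[t]` IS NORM-CONTINUOUS ON `[0,∞)`** (operators on the fixed space `L²(ℝ)`), the first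
input of Thm. 3.1 (2) (continuity of Suzuki's data in `t`). -/
theorem continuousOn_winOpL2 (hK : Continuous K) : ContinuousOn (fun t : ℝ => winOpL2 K hK t) (Ici 0) := by
  intro t₀ ht₀
  have ht₀' : 0 ≤ t₀ := ht₀
  rw [Metric.continuousWithinAt_iff]
  intro ε hε
  obtain ⟨C, hC0, hC⟩ := norm_winOpL2_sub_le_sqrt hK (t₀ + 1)
  -- choose `δ ≤ 1` with `C √(8(t₀+1)δ) < ε`
  set δ : ℝ := min 1 (ε ^ 2 / ((C + 1) ^ 2 * (8 * (t₀ + 1) + 1))) with hδ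
  have hδpos : 0 < δ := lt_min one_pos (by positivity)
  refine ⟨δ, hδpos, fun t ht hdist => ?_⟩
  have ht0 : 0 ≤ t := ht
  rw [dist_eq_norm] at hdist ⊢
  have habs : |t - t₀| < δ := by simpa [Real.norm_eq_abs] using hdist
  have hδ1 : δ ≤ 1 := min_le_left _ _
  -- the squared gap `(2·max)² − (2·min)² ≤ 8 (t₀+1) |t − t₀|`
  have key : ∀ a b : ℝ, 0 ≤ a → a ≤ b → b ≤ t₀ + 1 → b - a < δ →
      ‖winOpL2 K hK b - winOpL2 K hK a‖ < ε := by
    intro a b ha hab hb hgap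
    have h1 := hC a b ha hab hb
    have h2 : (2 * b) * (2 * b) - (2 * a) * (2 * a) ≤ 8 * (t₀ + 1) * (b - a) := by nlinarith
    have h3 : Real.sqrt ((2 * b) * (2 * b) - (2 * a) * (2 * a)) ≤ Real.sqrt (8 * (t₀ + 1) * δ) :=
      Real.sqrt_le_sqrt (h2.trans (by nlinarith))
    have h4 : C * Real.sqrt (8 * (t₀ + 1) * δ) < ε := by
      have hδle : δ ≤ ε ^ 2 / ((C + 1) ^ 2 * (8 * (t₀ + 1) + 1)) := min_le_right _ _
      have hpos : 0 < (C + 1) ^ 2 * (8 * (t₀ + 1) + 1) := by positivity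
      have h5 : (C + 1) ^ 2 * (8 * (t₀ + 1) * δ) < ε ^ 2 := by
        have hfrac : (C + 1) ^ 2 * (8 * (t₀ + 1) * δ) ≤ ε ^ 2 * (8 * (t₀ + 1)) / (8 * (t₀ + 1) + 1) := by
          calc (C + 1) ^ 2 * (8 * (t₀ + 1) * δ) = ((C + 1) ^ 2 * (8 * (t₀ + 1))) * δ := by ring
            _ ≤ ((C + 1) ^ 2 * (8 * (t₀ + 1))) * (ε ^ 2 / ((C + 1) ^ 2 * (8 * (t₀ + 1) + 1))) := by gcongr
            _ = ε ^ 2 * (8 * (t₀ + 1)) / (8 * (t₀ + 1) + 1) := by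
                have hC1 : (C + 1) ^ 2 ≠ 0 := by positivity
                field_simp
        have hlt : ε ^ 2 * (8 * (t₀ + 1)) / (8 * (t₀ + 1) + 1) < ε ^ 2 := by
          rw [div_lt_iff₀ (by positivity)]
          nlinarith [pow_pos hε 2]
        exact hfrac.trans_lt hlt
      have h6 : Real.sqrt (8 * (t₀ + 1) * δ) * (C + 1) < ε := by
        have := Real.sqrt_lt_sqrt (by positivity) h5
        rw [show (C + 1) ^ 2 * (8 * (t₀ + 1) * δ) = (Real.sqrt (8 * (t₀ + 1) * δ) * (C + 1)) ^ 2 by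
          rw [mul_pow, Real.sq_sqrt (by positivity)]; ring, Real.sqrt_sq (by positivity),
          Real.sqrt_sq hε.le] at this
        exact this
      nlinarith [Real.sqrt_nonneg (8 * (t₀ + 1) * δ)]
    calc ‖winOpL2 K hK b - winOpL2 K hK a‖ ≤ C * Real.sqrt ((2 * b) * (2 * b) - (2 * a) * (2 * a)) := h1
      _ ≤ C * Real.sqrt (8 * (t₀ + 1) * δ) := mul_le_mul_of_nonneg_left h3 hC0
      _ < ε := h4
  rcases le_or_gt t t₀ with hle | hgt
  · have := key t t₀ ht0 hle (by linarith) (by rw [abs_sub_comm] at habs; linarith [(abs_lt.1 habs).2, le_abs_self (t₀ - t)])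
    rwa [norm_sub_rev] at this
  · exact key t₀ t ht₀ hgt.le (by linarith [(abs_lt.1 habs).2]) (by linarith [(abs_lt.1 habs).2, le_abs_self (t - t₀)])

/-- RH-FREE. Hence the window norms `t ↦ ‖𝖪[t]‖` are continuous on `[0,∞)`. -/
theorem continuousOn_norm_winOpL2 (hK : Continuous K) :
    ContinuousOn (fun t : ℝ => ‖winOpL2 K hK t‖) (Ici 0) :=
  continuous_norm.comp_continuousOn (continuousOn_winOpL2 hK)

end Summit.RiemannHypothesis.RiemannHypothesis.Theorems.SuzukiStructureFunctions

end
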